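import Mathlib.NumberTheory.Zsqrtd.Basic
import Mathlib.Data.ZMod.Basic
import Mathlib.Data.Matrix.Basic
import Mathlib.LinearAlgebra.Matrix.Notation
import Mathlib.LinearAlgebra.Matrix.Adjugate
import Mathlib.RingTheory.Ideal.Span
import Mathlib.Tactic.IntervalCases
import Mathlib.Tactic.Linarith
import Mathlib.Tactic.LinearCombination
import Mathlib.Tactic.FinCases
import Mathlib.Tactic.NormNum

/-!
# Crux `RankOneTrivialisation` (stmt-ValiantsHypothesis-5667), line `nagata-multilinear-chart` —
Negative lemmas for stubs 1 and 2: `det = 0` (stub 1) and FACTORIALITY (stub 2) are load-bearing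

The line's three stubs are landed theorems
(`Summit.ValiantsHypothesis.Theorems.RankOneTrivialisation.stub_adjugate_twoByTwo_of_det_eq_zero`,
`….stub_ufdOuterProduct`, `….stub_degreeBudget_mod_homogeneous_prime`) and the crux is proved from them
(`Summit.ValiantsHypothesis.Theorems.rankOneTrivialisation_proof`).  This file completes the
kernel-checked MUTATION record of the line (stub 3's two hypotheses are treated in
`Negative/DegreeBudgetHypotheses.lean`): each theorem below is the statement of a stub with ONE
hypothesis dropped or weakened, refuted by an explicit small model.

* `adjugateTwoByTwo_false_without_det_eq_zero` — stub 1 without `B.det = 0` is false: `B = 1` over `ℤ`,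
  `m = 2` (`adj 1 = 1`, the minor `adj₀₀ adj₁₁ − adj₀₁ adj₁₀` is `1`).  (The OTHER hypothesis of stub 1,
  `IsDomain S`, is NOT load-bearing: Jacobi's complementary-minor identity makes the conclusion a
  consequence of `det B = 0` over every commutative ring — recorded on the item, not formalised.)
* `outerProduct_false_without_ufm` — stub 2 with `[UniqueFactorizationMonoid R]` weakened to
  `[IsDomain R]` is false: over the (Dedekind, non-factorial) domain `ℤ[√-5]` the rank-one matrix
  `B = [[2, 1 + √-5], [1 − √-5, 3]]` (`2·3 = (1 + √-5)(1 − √-5) = 6`) is not an outer product `c wᵀ`: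
  taking norms, `N(c₀)N(w₀) = 4`, `N(c₀)N(w₁) = 6`, `N(c₁)N(w₀) = 6`, `N(c₁)N(w₁) = 9`, and `ℤ[√-5]`
  has no element of norm `2` (`a² + 5b² = 2` is impossible mod `5`), so `N(c₀) ∈ {1, 4}`, and either
  choice makes `6` a multiple of `4`.  The witness even has UNIT CONTENT (`3 − 2 = 1`), so the
  stronger mutation "domain + unit content ⇒ outer product" (= `stub_unitContentRankOneFactors` of
  line `pic-not-cl` with `S_n` replaced by an arbitrary domain) is false as well:
  `outerProduct_false_without_ufm_of_unitContent`.  The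
  obstruction is the class of the invertible ideal `(2, 1 + √-5)` in `Pic ℤ[√-5] ≅ ℤ/2`; what the landed
  proof of stub 2 consumes is exactly gcd-extraction + cancellation.
* `outerProduct_false_over_zmod_four` — dropping factoriality AND integrality: over `ℤ/4` the rank-one
  matrix `diag(2, 2)` is not an outer product (finite check).

All statements are inline negations (no new `def … : Prop`), Mathlib-only imports. [folklore]
(drefute gen 4, refuter-drefute-stmt-ValiantsHypothesis-5667-g4-0.)
-/

namespace Summit.ValiantsHypothesis.Theorems.RankOneTrivialisation.Negative

open Matrix

/-! ## Stub 1 without `det = 0` -/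

/-- Stub 1 (`stub_adjugate_twoByTwo_of_det_eq_zero`) with the hypothesis `B.det = 0` deleted is false:
the identity matrix of size `2` over `ℤ` has `adj 1 = 1`, whose `2 × 2` minor is `1 ≠ 0`. [folklore] -/
theorem adjugateTwoByTwo_false_without_det_eq_zero :
    ¬ ∀ (S : Type) [CommRing S] [IsDomain S] (m : ℕ) (B : Matrix (Fin m) (Fin m) S),
        ∀ i j k l : Fin m, B.adjugate i j * B.adjugate k l = B.adjugate i l * B.adjugate k j := by
  intro h
  have h1 := h ℤ 2 1 0 0 1 1
  rw [adjugate_one] at h1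
  have e1 : (1 : Matrix (Fin 2) (Fin 2) ℤ) 0 0 = 1 := rfl
  have e2 : (1 : Matrix (Fin 2) (Fin 2) ℤ) 1 1 = 1 := rfl
  have e3 : (1 : Matrix (Fin 2) (Fin 2) ℤ) 0 1 = 0 := rfl
  rw [e1, e2, e3] at h1
  norm_num at h1

/-! ## Stub 2 without factoriality: the domain `ℤ[√-5]` -/

/-- `ℤ[√-5]` is an integral domain (the norm `a² + 5b²` is multiplicative and vanishes only at `0`).
[folklore] -/
theorem isDomain_zsqrtd_negFive : IsDomain (ℤ√(-5)) := by
  have : NoZeroDivisors (ℤ√(-5)) := ⟨fun {a b} hab => by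
    have hn := congrArg Zsqrtd.norm hab
    rw [Zsqrtd.norm_mul, Zsqrtd.norm_zero, mul_eq_zero] at hn
    rcases hn with hn | hn
    · exact Or.inl ((Zsqrtd.norm_eq_zero_iff (by norm_num) a).mp hn)
    · exact Or.inr ((Zsqrtd.norm_eq_zero_iff (by norm_num) b).mp hn)⟩
  exact NoZeroDivisors.to_isDomain _

/-- No element of `ℤ[√-5]` has norm `2`: `a² + 5b² ≡ a² (mod 5)` and `2` is not a square mod `5`.
[folklore] -/
theorem zsqrtd_negFive_norm_ne_two (z : ℤ√(-5)) : z.norm ≠ 2 := by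
  intro h
  rw [Zsqrtd.norm_def] at h
  have h' : z.re * z.re + 5 * (z.im * z.im) = 2 := by linear_combination h
  have key : ∀ x y : ZMod 5, x * x + 5 * (y * y) ≠ 2 := by decide
  have hc := congrArg (Int.cast : ℤ → ZMod 5) h'
  push_cast at hc
  exact key _ _ hc

/-- Norm chase: the entries `2, 1 + √-5, 1 - √-5, 3` of the witness matrix are not of the form
`c₀w₀, c₀w₁, c₁w₀, c₁w₁` in `ℤ[√-5]`. [folklore] -/
theorem zsqrtd_negFive_no_factorisation (c₀ c₁ w₀ w₁ : ℤ√(-5))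
    (h00 : (⟨2, 0⟩ : ℤ√(-5)) = c₀ * w₀) (h01 : (⟨1, 1⟩ : ℤ√(-5)) = c₀ * w₁)
    (h10 : (⟨1, -1⟩ : ℤ√(-5)) = c₁ * w₀) (h11 : (⟨3, 0⟩ : ℤ√(-5)) = c₁ * w₁) : False := by
  have n00 := congrArg Zsqrtd.norm h00
  have n01 := congrArg Zsqrtd.norm h01
  have n10 := congrArg Zsqrtd.norm h10
  have n11 := congrArg Zsqrtd.norm h11
  rw [Zsqrtd.norm_mul] at n00 n01 n10 n11
  have e00 : Zsqrtd.norm (⟨2, 0⟩ : ℤ√(-5)) = 4 := by decide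
  have e01 : Zsqrtd.norm (⟨1, 1⟩ : ℤ√(-5)) = 6 := by decide
  have e10 : Zsqrtd.norm (⟨1, -1⟩ : ℤ√(-5)) = 6 := by decide
  have e11 : Zsqrtd.norm (⟨3, 0⟩ : ℤ√(-5)) = 9 := by decide
  rw [e00] at n00
  rw [e01] at n01
  rw [e10] at n10
  rw [e11] at n11
  have hx0 : 0 ≤ c₀.norm := Zsqrtd.norm_nonneg (by norm_num) _
  have hy0 : 0 ≤ w₀.norm := Zsqrtd.norm_nonneg (by norm_num) _
  have hu0 : 0 ≤ c₁.norm := Zsqrtd.norm_nonneg (by norm_num) _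
  have hv0 : 0 ≤ w₁.norm := Zsqrtd.norm_nonneg (by norm_num) _
  have hx2 : c₀.norm ≠ 2 := zsqrtd_negFive_norm_ne_two c₀
  -- integer bookkeeping on the four norms
  generalize c₀.norm = x at *
  generalize w₀.norm = y at *
  generalize c₁.norm = u at *
  generalize w₁.norm = v at *
  have hxle : x ≤ 4 := by
    rcases eq_or_lt_of_le hy0 with hy | hy
    · subst hy; simp at n00
    · nlinarith
  interval_cases x
  · simp at n00
  · obtain rfl : y = 4 := by linarith
    omega
  · exact hx2 rfl
  · omega
  · obtain rfl : y = 1 := by linarith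
    omega

/-- Stub 2 (`stub_ufdOuterProduct`) with factoriality weakened to "`R` a domain and `B` of UNIT
CONTENT" is false: witness `R = ℤ[√-5]`, `B = [[2, 1 + √-5], [1 − √-5, 3]]` (all `2 × 2` minors
vanish, `3 − 2 = 1` is in the content ideal, no outer-product factorisation).  The quantified
statement is, symbol for symbol, `stub_unitContentRankOneFactors` of line `pic-not-cl` with the specific
ring `S_n = ℂ[x]⧸(per_n)` (`n ≥ 3`) replaced by an arbitrary domain `R`: that stub genuinely needs a
property of `S_n` (`Pic = 0`, or factoriality), exactly as its card says. [folklore] -/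
theorem outerProduct_false_without_ufm_of_unitContent :
    ¬ ∀ (R : Type) [CommRing R] [IsDomain R] (m : ℕ) (B : Matrix (Fin m) (Fin m) R),
        (∀ i j k l : Fin m, B i j * B k l = B i l * B k j) →
        Ideal.span (Set.range fun p : Fin m × Fin m => B p.1 p.2) = ⊤ →
        ∃ c w : Fin m → R, ∀ i j, B i j = c i * w j := by
  intro h
  haveI : IsDomain (ℤ√(-5)) := isDomain_zsqrtd_negFive
  have hmin : ∀ i j k l : Fin 2,
      (!![(⟨2, 0⟩ : ℤ√(-5)), ⟨1, 1⟩; ⟨1, -1⟩, ⟨3, 0⟩] : Matrix (Fin 2) (Fin 2) (ℤ√(-5))) i j *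
        !![(⟨2, 0⟩ : ℤ√(-5)), ⟨1, 1⟩; ⟨1, -1⟩, ⟨3, 0⟩] k l =
      (!![(⟨2, 0⟩ : ℤ√(-5)), ⟨1, 1⟩; ⟨1, -1⟩, ⟨3, 0⟩] : Matrix (Fin 2) (Fin 2) (ℤ√(-5))) i l *
        !![(⟨2, 0⟩ : ℤ√(-5)), ⟨1, 1⟩; ⟨1, -1⟩, ⟨3, 0⟩] k j := by
    decide
  have hcontent : Ideal.span (Set.range fun p : Fin 2 × Fin 2 =>
      (!![(⟨2, 0⟩ : ℤ√(-5)), ⟨1, 1⟩; ⟨1, -1⟩, ⟨3, 0⟩] : Matrix (Fin 2) (Fin 2) (ℤ√(-5))) p.1 p.2) = ⊤ := by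
    rw [Ideal.eq_top_iff_one]
    have h11 : (!![(⟨2, 0⟩ : ℤ√(-5)), ⟨1, 1⟩; ⟨1, -1⟩, ⟨3, 0⟩] : Matrix (Fin 2) (Fin 2) (ℤ√(-5))) 1 1 ∈
        Ideal.span (Set.range fun p : Fin 2 × Fin 2 =>
          (!![(⟨2, 0⟩ : ℤ√(-5)), ⟨1, 1⟩; ⟨1, -1⟩, ⟨3, 0⟩] : Matrix (Fin 2) (Fin 2) (ℤ√(-5))) p.1 p.2) :=
      Ideal.subset_span ⟨(1, 1), rfl⟩
    have h00 : (!![(⟨2, 0⟩ : ℤ√(-5)), ⟨1, 1⟩; ⟨1, -1⟩, ⟨3, 0⟩] : Matrix (Fin 2) (Fin 2) (ℤ√(-5))) 0 0 ∈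
        Ideal.span (Set.range fun p : Fin 2 × Fin 2 =>
          (!![(⟨2, 0⟩ : ℤ√(-5)), ⟨1, 1⟩; ⟨1, -1⟩, ⟨3, 0⟩] : Matrix (Fin 2) (Fin 2) (ℤ√(-5))) p.1 p.2) :=
      Ideal.subset_span ⟨(0, 0), rfl⟩
    have e : (1 : ℤ√(-5)) =
        (!![(⟨2, 0⟩ : ℤ√(-5)), ⟨1, 1⟩; ⟨1, -1⟩, ⟨3, 0⟩] : Matrix (Fin 2) (Fin 2) (ℤ√(-5))) 1 1 -
        (!![(⟨2, 0⟩ : ℤ√(-5)), ⟨1, 1⟩; ⟨1, -1⟩, ⟨3, 0⟩] : Matrix (Fin 2) (Fin 2) (ℤ√(-5))) 0 0 := by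
      decide
    rw [e]
    exact Ideal.sub_mem _ h11 h00
  obtain ⟨c, w, hcw⟩ := h (ℤ√(-5)) 2 _ hmin hcontent
  exact zsqrtd_negFive_no_factorisation (c 0) (c 1) (w 0) (w 1)
    (by simpa using hcw 0 0) (by simpa using hcw 0 1) (by simpa using hcw 1 0) (by simpa using hcw 1 1)

/-- Stub 2 (`stub_ufdOuterProduct`) with `[UniqueFactorizationMonoid R]` weakened to `[IsDomain R]`
is false (witness `ℤ[√-5]`, as above): factoriality, not integrality, is what the gcd extraction
consumes. [folklore] -/
theorem outerProduct_false_without_ufm :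
    ¬ ∀ (R : Type) [CommRing R] [IsDomain R] (m : ℕ) (B : Matrix (Fin m) (Fin m) R),
        (∀ i j k l : Fin m, B i j * B k l = B i l * B k j) →
        ∃ c w : Fin m → R, ∀ i j, B i j = c i * w j :=
  fun h => outerProduct_false_without_ufm_of_unitContent fun R _ _ m B hB _ => h R m B hB

/-! ## Stub 2 without factoriality and integrality: a finite witness -/

/-- Over `ℤ/4` the rank-one matrix `diag(2, 2)` is not an outer product: stub 2 with
`[UniqueFactorizationMonoid R]` simply deleted fails already for a finite ring. [folklore] -/
theorem outerProduct_false_over_zmod_four :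
    ¬ ∀ (R : Type) [CommRing R] (m : ℕ) (B : Matrix (Fin m) (Fin m) R),
        (∀ i j k l : Fin m, B i j * B k l = B i l * B k j) →
        ∃ c w : Fin m → R, ∀ i j, B i j = c i * w j := by
  intro h
  have hmin : ∀ i j k l : Fin 2,
      (!![(2 : ZMod 4), 0; 0, 2] : Matrix (Fin 2) (Fin 2) (ZMod 4)) i j * !![(2 : ZMod 4), 0; 0, 2] k l =
      (!![(2 : ZMod 4), 0; 0, 2] : Matrix (Fin 2) (Fin 2) (ZMod 4)) i l * !![(2 : ZMod 4), 0; 0, 2] k j := by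
    decide
  obtain ⟨c, w, hcw⟩ := h (ZMod 4) 2 _ hmin
  have key : ∀ a b x y : ZMod 4, (2 : ZMod 4) = a * x → (0 : ZMod 4) = a * y →
      (0 : ZMod 4) = b * x → (2 : ZMod 4) = b * y → False := by
    decide
  exact key (c 0) (c 1) (w 0) (w 1)
    (by simpa using hcw 0 0) (by simpa using hcw 0 1) (by simpa using hcw 1 0) (by simpa using hcw 1 1)

end Summit.ValiantsHypothesis.Theorems.RankOneTrivialisation.Negative
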